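import Summits.Schanuel.Schanuel.Theorems.RootDecomp1KXAll02

/-!
# RootDecomp1KXAll — lens 1, generation 46, node 5 «ALL CURVES: ThinFibreAt m₀ P for EVERY P ∈ ℤ[x][Y], P ≠ 0, at every m₀ ≥ thinThreshold P = max(3, 2·μ(P)+1, e(P)+1)» (CLAIM L2336, PRICE + CHECKLIST K-g46 L2337, NODE L2353, critic VERDICT L2357: CLEARED THEOREM ×1 under K-R35 — the last threshold-THEOREM of the K-line, UNCONDITIONAL; PORT GO L2357) — continuation (RootDecomp1KXAll03): §XIV.5 the parametric theorem, §XIV.6 every P: thinFibreAt_all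

(lens-1 g46 HOME kernel K₅ = HOME/decomp-schanuel-lens-1/g46/XAll.lean 4f432885…, 1310 l, ONE import …RootDecomp1KXTop03; P₅/C₅ + NODE-g46.md. Port by census-1 gen 20 as `RootDecomp1KXAll01–06` (the memo's 01–05 split with §XIV.8 cut in two by the 400-line cap): 01 = private helper copies + §XIV.1 roots with multiplicity in `ℂ₂` and the nearest-root lemma without separability (`roots_data_mult`, `nearest_root_mult`, `rootMultiplicity_le_one_of_separable`, `rootMultiplicity_le_natDegree'`) + §XIV.2 Ridout for rationals with exponent `κ = a/b > 2` (`ridout_one_pow`, `ridout_window_pow`; tree `Ridout.finite_of_abs_le_one` BY NAME, called once); 02 = §XIV.3 the dichotomy with multiplicity (`near_root_or_at_infinity_mult`) + §XIV.4 its arithmetic end (`dichotomy_arith_mult`); 03 = §XIV.5 THE PARAMETRIC THEOREM `thinFibreAt_xPoly_mult` (+ `_claim`, `_again` private, `_crude`) + §XIV.6 every `P ∈ ℤ[x][Y]` (`xCoeff`, `topX`, `eTop`, `muTop`, `thinThreshold`, `xPolyP_xCoeff`, **`thinFibreAt_all`**, `thinFibreAt_effective`); 04 = §XIV.7 CONSUMER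 for all x-degrees (`xCoeff_dX`, …, `thinThreshold_dX_le`, `no_relation_of_closed_class`, `allCurves_nonvanishing`); 05 = §XIV.8 thresholds of `xPolyP k c` in the data `(μ, e)`, specialisations BY NAME (examples against tree `…XTop.thinFibreAt_xPoly`, `…XLinearII.thinFibreAt_xLinear_sep`, `ridout_window`, `dichotomy_arith`), root-multiplicity bounds, the P₃-family `thinFibreAt_purePowerTop`; 06 = members P₁ P₂ P₃ with thresholds 5 / 7 / 5 proved as theorems + CONSUMER at the members.
PORT EDITS (sanctioned in VERDICT L2357 (a)–(e)): `set_option linter.dupNamespace false` dropped; `thinFibreAt_xPoly_again` and `thinFibreAt_xLinear_sep_again` (type-twins of tree `…XTop.thinFibreAt_xPoly` / `…XLinearII.thinFibreAt_xLinear_sep`) made `private` (dedup); per-part private helper copies; the two scoped `set_option maxHeartbeats 400000 in` kept as in K₅; `example` blocks kept; 19 one-line docstrings added (gate lint.docstring); statements and proofs otherwise verbatim. `--supports stmt-Schanuel-33364`; no census credit carried; rung 0 — nothing here proves Schanuel; no ∀-item of 1K moves.)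
-/

noncomputable section

namespace Summit.Schanuel.Schanuel.Theorems.RootDecomp1KXAll

open Polynomial LiouvilleNumber
open scoped Nat
open Summit.Schanuel.Schanuel.Theorems.RootDecomp1KSkelCell
  (exists_le_two_pow_factorial iota iota_spec iota_le_of_le pow_lt_of_lt_iota lt_iota_of_pow_lt iota_mono
   one_le_iota SkelLiouville SkelLiouvilleFix skelLiouville_iff_fix SkelLiouvilleFix.mono uStar dU rU dU_cast
   two_pow_le_four_mul_dU two_mul_dU_lt one_le_dU rU_den rU_cast uStar_sub_rU skelLiouvilleFix_one_uStar
   not_skelFixOne_algebraicIndependent)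
open Summit.Schanuel.Schanuel.Theorems.RootDecomp1KTwoBaseCell (psNumer partialSum_eq_psNumer_div coprime_psNumer
  algebraicIndependent_of_forall_int')
open Summit.Schanuel.Schanuel.Theorems.RootDecomp1KRelLiouvilleCell (partialSum_two_strictMono
  partialSum_two_lt_liouvilleNumber abs_liouvilleNumber_two_sub_partialSum)
open Summit.Schanuel.Schanuel.Theorems.RootDecomp1KDegreeLadder
open Summit.Schanuel.Schanuel.Theorems.RootDecomp1KXLinearCore
open Summit.Schanuel.Schanuel.Theorems.RootDecomp1KXLinear
open Summit.Schanuel.Schanuel.Theorems.RootDecomp1KXLinearII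
open Summit.Schanuel.Schanuel.Theorems.RootDecomp1KXTop

/-! ## §XIV.5  THE PARAMETRIC THEOREM: top `x`-coefficient with roots of multiplicity `≤ μ` -/

set_option maxHeartbeats 400000 in
/-- **MULTIPLE FINITE POINTS OVER `x = ∞` ⇒ THIN FIBRES FOR EVERY `m₀ ≥ max(3, 2μ+1, e+1)`.**  For every
`x`-degree `k`, every `e` and every `μ ≥ 1`: if the top `x`-coefficient `c_k ≠ 0` of `P = Σ_{j ≤ k} x^j c_j(Y)` has all
its roots in `ℂ₂` of multiplicity `≤ μ` and `deg c_j ≤ deg c_k + e` (`j < k`), then `ThinFibreAt m₀ P` for all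
`m₀ ≥ 3` with `m₀ ≥ 2μ + 1` and `m₀ ≥ e + 1`.  (Ridout for rationals enters BY TREE NAME through `ridout_window_pow`
at `(a, b) = (4μ+1, 2μ)`; the `(∞, ∞)` part uses no Diophantine input.) -/
theorem thinFibreAt_xPoly_mult (k : ℕ) (c : ℕ → ℤ[X]) (e μ : ℕ) (hB : c k ≠ 0) (hμ : 1 ≤ μ)
    (hmult : ∀ β : PadicAlgCl 2, rootMultiplicity β ((c k).map (algebraMap ℤ (PadicAlgCl 2))) ≤ μ)
    (hdeg : ∀ j, j < k → (c j).natDegree ≤ (c k).natDegree + e)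
    {m₀ : ℕ} (hm : 2 * μ + 1 ≤ m₀) (hme : e + 1 ≤ m₀) : ThinFibreAt m₀ (xPolyP k c) := by
  classical
  have hℓpos : 0 < ‖((c k).leadingCoeff : PadicAlgCl 2)‖ := by
    rw [norm_pos_iff]; exact_mod_cast leadingCoeff_ne_zero.mpr hB
  intro C
  obtain ⟨N₄, hN₄⟩ := infinity_arith ‖((c k).leadingCoeff : PadicAlgCl 2)‖ C hℓpos e
  -- the `(∞, ∞)` end (no Diophantine input): `‖lc‖·2^{N!} ≤ ‖r‖₂^e ≤ den(r)^e`
  have hinf : ∀ N, N₄ ≤ N → ∀ r : ℚ,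
      ‖((c k).leadingCoeff : PadicAlgCl 2)‖ * 2 ^ N ! ≤ ‖(r : PadicAlgCl 2)‖ ^ e →
      C * 2 ^ (N + 1)! < (r.den : ℝ) ^ (m₀ * N) := by
    intro N hN r hfar
    have hd1 : (1 : ℝ) ≤ r.den := by exact_mod_cast Nat.succ_le_of_lt r.den_pos
    have hfar' : ‖((c k).leadingCoeff : PadicAlgCl 2)‖ * 2 ^ N ! ≤ (r.den : ℝ) ^ e :=
      hfar.trans (pow_le_pow_left₀ (norm_nonneg _) (norm_ratCast_le_den r) e)
    have h := hN₄ N hN r.den (Nat.succ_le_of_lt r.den_pos) hfar'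
    exact h.trans_le (pow_le_pow_right₀ hd1 (Nat.mul_le_mul_right _ hme))
  by_cases hd : 1 ≤ (c k).natDegree
  · obtain ⟨T, cc, N₁, hcc, hTroots, hclose⟩ := near_root_or_at_infinity_mult k c e μ hd hmult hdeg
    obtain ⟨N₂, hN₂⟩ := dichotomy_arith_mult μ cc C
    have hF := ridout_window_pow (c k) hd C (4 * μ + 1) (2 * μ) (by omega) (by omega)
    have hbad : (⋃ r ∈ {r : ℚ | |(r : ℝ)| ≤ C ∧ ∃ β : PadicAlgCl 2, aeval β (c k) = 0 ∧
        (r.den : ℝ) ^ (4 * μ + 1) *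
          ‖((c k).leadingCoeff : PadicAlgCl 2) * ((r : PadicAlgCl 2) - β)‖ ^ (2 * μ) ≤ 1},
        {N : ℕ | bev (xPolyP k c) (partialSum 2 N) r = 0 ∧ ∃ x : ℝ, bev (xPolyP k c) x r ≠ 0}).Finite := by
      refine hF.biUnion fun r _ => ?_
      by_cases hnd : ∃ x : ℝ, bev (xPolyP k c) x r ≠ 0
      · exact (levels_finite_of_nondeg _ r hnd).subset fun N hN => hN.1
      · exact Set.finite_empty.subset fun N hN => (hnd hN.2).elim
    obtain ⟨N₃, hN₃⟩ := hbad.bddAbove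
    refine ⟨max (max N₁ N₂) (max (N₃ + 1) N₄), fun N hN r hr hP hnd => ?_⟩
    have hNN₁ : N₁ ≤ N := le_trans (le_trans (le_max_left _ _) (le_max_left _ _)) hN
    have hNN₂ : N₂ ≤ N := le_trans (le_trans (le_max_right _ _) (le_max_left _ _)) hN
    have hNN₃ : N₃ + 1 ≤ N := le_trans (le_trans (le_max_left _ _) (le_max_right _ _)) hN
    have hNN₄ : N₄ ≤ N := le_trans (le_trans (le_max_right _ _) (le_max_right _ _)) hN
    rcases hclose N hNN₁ r hP with ⟨β, hβT, hx⟩ | ⟨_, hfar⟩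
    · -- near a finite point over `x = ∞` of multiplicity `≤ μ`: Ridout with exponent `2 + 1/(2μ)`, or far
      have hnot : ¬ ((r.den : ℝ) ^ (4 * μ + 1) *
          ‖((c k).leadingCoeff : PadicAlgCl 2) * ((r : PadicAlgCl 2) - β)‖ ^ (2 * μ) ≤ 1) := by
        intro hineq
        have hmem : N ∈ ⋃ r ∈ {r : ℚ | |(r : ℝ)| ≤ C ∧ ∃ β : PadicAlgCl 2, aeval β (c k) = 0 ∧
            (r.den : ℝ) ^ (4 * μ + 1) *
              ‖((c k).leadingCoeff : PadicAlgCl 2) * ((r : PadicAlgCl 2) - β)‖ ^ (2 * μ) ≤ 1},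
            {N : ℕ | bev (xPolyP k c) (partialSum 2 N) r = 0 ∧ ∃ x : ℝ, bev (xPolyP k c) x r ≠ 0} :=
          Set.mem_biUnion (x := r) ⟨hr, β, hTroots β hβT, hineq⟩ ⟨hP, hnd⟩
        have := hN₃ hmem
        omega
      have h3' := hN₂ N hNN₂ r.den _ (Nat.succ_le_of_lt r.den_pos) (norm_nonneg _) hx hnot
      have hd1 : (1 : ℝ) ≤ r.den := by exact_mod_cast Nat.succ_le_of_lt r.den_pos
      exact h3'.trans_le (pow_le_pow_right₀ hd1 (Nat.mul_le_mul_right _ hm))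
    · exact hinf N hNN₄ r hfar
  · -- constant (non-zero) top coefficient: only the `(∞, ∞)` alternative
    have hd0 : (c k).natDegree = 0 := by omega
    obtain ⟨N₁, hN₁⟩ := at_infinity_of_const_top k c e hB hd0 hdeg
    refine ⟨max N₁ N₄, fun N hN r _ hP _ => ?_⟩
    obtain ⟨_, hfar⟩ := hN₁ N (le_trans (le_max_left _ _) hN) r hP
    exact hinf N (le_trans (le_max_right _ _) hN) r hfar

/-- the CLAIM's literal binder list (bus L2336), with the redundant `3 ≤ m₀` (implied by `1 ≤ μ`, `2μ+1 ≤ m₀`). -/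
theorem thinFibreAt_xPoly_mult_claim (k : ℕ) (c : ℕ → ℤ[X]) (e μ : ℕ) (hB : c k ≠ 0) (hμ : 1 ≤ μ)
    (hmult : ∀ β : PadicAlgCl 2, rootMultiplicity β ((c k).map (algebraMap ℤ (PadicAlgCl 2))) ≤ μ)
    (hdeg : ∀ j, j < k → (c j).natDegree ≤ (c k).natDegree + e)
    {m₀ : ℕ} (_h3 : 3 ≤ m₀) (hm : 2 * μ + 1 ≤ m₀) (hme : e + 1 ≤ m₀) : ThinFibreAt m₀ (xPolyP k c) :=
  thinFibreAt_xPoly_mult k c e μ hB hμ hmult hdeg hm hme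

/-- `μ = 1`: node 4 (g45d) `thinFibreAt_xPoly` RE-DERIVED ON THE NOSE — separable top coefficient, every
`m₀ ≥ max(3, e + 1)`. -/
private theorem thinFibreAt_xPoly_again (k : ℕ) (c : ℕ → ℤ[X]) (e : ℕ)
    (hsep : ((c k).map (Int.castRingHom ℚ)).Separable) (hdeg : ∀ j, j < k → (c j).natDegree ≤ (c k).natDegree + e)
    {m₀ : ℕ} (hm : 3 ≤ m₀) (hme : e + 1 ≤ m₀) : ThinFibreAt m₀ (xPolyP k c) := by
  have hB : c k ≠ 0 := by
    intro h
    rw [h, Polynomial.map_zero] at hsep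
    exact not_separable_zero hsep
  exact thinFibreAt_xPoly_mult k c e 1 hB le_rfl (rootMultiplicity_le_one_of_separable (c k) hsep) hdeg
    (by omega) hme

/-- the CRUDE explicit form (no root data): `μ := deg c_k`, every `m₀ ≥ max(3, 2·deg c_k + 1, e + 1)`. -/
theorem thinFibreAt_xPoly_crude (k : ℕ) (c : ℕ → ℤ[X]) (e : ℕ) (hB : c k ≠ 0)
    (hdeg : ∀ j, j < k → (c j).natDegree ≤ (c k).natDegree + e)
    {m₀ : ℕ} (h3 : 3 ≤ m₀) (hm : 2 * (c k).natDegree + 1 ≤ m₀) (hme : e + 1 ≤ m₀) :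
    ThinFibreAt m₀ (xPolyP k c) := by
  by_cases hd : 1 ≤ (c k).natDegree
  · exact thinFibreAt_xPoly_mult k c e (c k).natDegree hB hd (rootMultiplicity_le_natDegree' (c k)) hdeg hm hme
  · -- constant top: `μ := 1` is admissible (no roots at all)
    have hd0 : (c k).natDegree = 0 := by omega
    refine thinFibreAt_xPoly_mult k c e 1 hB le_rfl (fun β => ?_) hdeg (by omega) hme
    exact (rootMultiplicity_le_natDegree' (c k) β).trans (by omega)

/-! ## §XIV.6  EVERY `P ∈ ℤ[x][Y]`: the `x`-coefficients, the conversion `P = xPolyP (xdeg P) (xCoeff P)`,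
the explicit threshold `thinThreshold P`, and the theorem `thinFibreAt_all` -/

/-- the `j`-th `x`-coefficient of `P = Σ_i P_i(x)·Y^i ∈ ℤ[x][Y]`, as a polynomial in `Y`:
`xCoeff P j = Σ_i (P_i)_j · Y^i`. -/
def xCoeff (P : ℤ[X][X]) (j : ℕ) : ℤ[X] :=
  ∑ i ∈ Finset.range (P.natDegree + 1), C ((P.coeff i).coeff j) * X ^ i

/-- coefficients of `xCoeff`. -/
theorem coeff_xCoeff (P : ℤ[X][X]) (j i : ℕ) : (xCoeff P j).coeff i = (P.coeff i).coeff j := by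
  unfold xCoeff
  rw [finsetSum_coeff]
  simp only [coeff_C_mul, coeff_X_pow, mul_ite, mul_one, mul_zero]
  rw [Finset.sum_ite_eq]
  split_ifs with h
  · rfl
  · rw [coeff_eq_zero_of_natDegree_lt (p := P) (by simpa using h)]
    simp

/-- `deg (xCoeff P j) ≤ deg_Y P`. -/
theorem natDegree_xCoeff_le (P : ℤ[X][X]) (j : ℕ) : (xCoeff P j).natDegree ≤ P.natDegree := by
  unfold xCoeff
  refine (natDegree_sum_le _ _).trans (Finset.sup_le fun i hi => ?_)
  exact (natDegree_C_mul_X_pow_le _ _).trans (by have := Finset.mem_range.mp hi; omega)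

/-- `xCoeff P j = 0` beyond the `x`-degree. -/
theorem xCoeff_eq_zero_of_lt (P : ℤ[X][X]) {j : ℕ} (hj : xdeg P < j) : xCoeff P j = 0 := by
  ext i
  rw [coeff_xCoeff, coeff_zero]
  exact coeff_eq_zero_of_natDegree_lt ((natDegree_coeff_le_xdeg P i).trans_lt hj)

/-- `j ≤ xdeg P` as soon as `xCoeff P j ≠ 0`. -/
theorem le_xdeg_of_xCoeff_ne_zero {P : ℤ[X][X]} {j : ℕ} (h : xCoeff P j ≠ 0) : j ≤ xdeg P := by
  by_contra hlt
  push Not at hlt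
  exact h (xCoeff_eq_zero_of_lt P hlt)

/-- the `Y^i`-coefficient of `xPolyP k c` is `Σ_{j ≤ k} (c_j)_i · x^j`. -/
theorem coeff_xPolyP (k : ℕ) (c : ℕ → ℤ[X]) (i : ℕ) :
    (xPolyP k c).coeff i = ∑ j ∈ Finset.range (k + 1), C ((c j).coeff i) * X ^ j := by
  unfold xPolyP
  rw [finsetSum_coeff]
  refine Finset.sum_congr rfl fun j _ => ?_
  rw [coeff_C_mul, coeff_map, mul_comm]

/-- … and its `x^j`-coefficient. -/
theorem coeff_coeff_xPolyP (k : ℕ) (c : ℕ → ℤ[X]) (i j : ℕ) :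
    ((xPolyP k c).coeff i).coeff j = if j ∈ Finset.range (k + 1) then (c j).coeff i else 0 := by
  rw [coeff_xPolyP, finsetSum_coeff]
  simp only [coeff_C_mul, coeff_X_pow, mul_ite, mul_one, mul_zero]
  rw [Finset.sum_ite_eq]

/-- **the conversion**: every `P ∈ ℤ[x][Y]` is `xPolyP (xdeg P) (xCoeff P)`. -/
theorem xPolyP_xCoeff (P : ℤ[X][X]) : xPolyP (xdeg P) (xCoeff P) = P := by
  ext i j
  rw [coeff_coeff_xPolyP]
  split_ifs with h
  · exact coeff_xCoeff P j i
  · rw [Finset.mem_range, not_lt] at h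
    exact (coeff_eq_zero_of_natDegree_lt ((natDegree_coeff_le_xdeg P i).trans_lt (by omega))).symm

/-- the TOP `x`-coefficient `c_k`, `k = xdeg P`. -/
def topX (P : ℤ[X][X]) : ℤ[X] := xCoeff P (xdeg P)

/-- `c_k ≠ 0` for `P ≠ 0`. -/
theorem topX_ne_zero {P : ℤ[X][X]} (hP : P ≠ 0) : topX P ≠ 0 := by
  classical
  obtain ⟨i, -, hieq⟩ := Finset.exists_mem_eq_sup (Finset.range (P.natDegree + 1))
    ⟨0, Finset.mem_range.mpr (Nat.succ_pos _)⟩ (fun j => (P.coeff j).natDegree)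
  have hxi : xdeg P = (P.coeff i).natDegree := hieq
  by_cases hx : xdeg P = 0
  · intro h0
    have h1 : (topX P).coeff P.natDegree = (P.coeff P.natDegree).coeff (xdeg P) := coeff_xCoeff _ _ _
    rw [h0, coeff_zero, hx] at h1
    have hdeg0 : (P.coeff P.natDegree).natDegree = 0 := by
      have := natDegree_coeff_le_xdeg P P.natDegree; omega
    have hC := eq_C_of_natDegree_eq_zero hdeg0
    apply leadingCoeff_ne_zero.mpr hP
    rw [leadingCoeff, hC, ← h1, C_0]
  · intro h0
    have hne : P.coeff i ≠ 0 := by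
      intro h; rw [h, natDegree_zero] at hxi; exact hx hxi
    have h1 : (topX P).coeff i = (P.coeff i).coeff (xdeg P) := coeff_xCoeff _ _ _
    rw [h0, coeff_zero, hxi] at h1
    exact leadingCoeff_ne_zero.mpr hne h1.symm

/-- `deg c_k ≤ deg_Y P`. -/
theorem natDegree_topX_le (P : ℤ[X][X]) : (topX P).natDegree ≤ P.natDegree := natDegree_xCoeff_le _ _

/-- `e(P)`: the order of the point `(∞, ∞)` = `deg_Y P − deg c_k` (`= max_j deg c_j − deg c_k`). -/
def eTop (P : ℤ[X][X]) : ℕ := P.natDegree - (topX P).natDegree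

/-- `μ(P)`: the largest multiplicity of a root of the top `x`-coefficient `c_k` in `ℂ₂ = PadicAlgCl 2`
(`0` iff `c_k` has no root, i.e. is constant; `≤ 1` iff `c_k` is separable). -/
def muTop (P : ℤ[X][X]) : ℕ := by
  classical
  exact ((topX P).map (algebraMap ℤ (PadicAlgCl 2))).roots.toFinset.sup
    fun β => rootMultiplicity β ((topX P).map (algebraMap ℤ (PadicAlgCl 2)))

/-- every root multiplicity of `c_k` is `≤ μ(P)`. -/
theorem rootMultiplicity_le_muTop (P : ℤ[X][X]) (β : PadicAlgCl 2) :
    rootMultiplicity β ((topX P).map (algebraMap ℤ (PadicAlgCl 2))) ≤ muTop P := by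
  classical
  set p := (topX P).map (algebraMap ℤ (PadicAlgCl 2)) with hp
  by_cases h : rootMultiplicity β p = 0
  · rw [h]; exact Nat.zero_le _
  · have hp0 : p ≠ 0 := by intro h0; apply h; rw [h0, rootMultiplicity_zero]
    have hroot : β ∈ p.roots.toFinset := by
      rw [Multiset.mem_toFinset, mem_roots hp0]
      exact (rootMultiplicity_pos hp0).mp (Nat.pos_of_ne_zero h)
    unfold muTop
    exact Finset.le_sup (f := fun β => rootMultiplicity β p) hroot

/-- `μ(P) ≤ 1` when `c_k` is separable (node 4's class), `μ(P) ≤ deg c_k` always. -/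
theorem muTop_le_one_of_separable (P : ℤ[X][X]) (hsep : ((topX P).map (Int.castRingHom ℚ)).Separable) :
    muTop P ≤ 1 := by
  classical
  unfold muTop
  exact Finset.sup_le fun β _ => rootMultiplicity_le_one_of_separable _ hsep β

/-- `muTop P ≤ deg (topX P)` (a multiplicity never exceeds the degree). -/
theorem muTop_le_natDegree (P : ℤ[X][X]) : muTop P ≤ (topX P).natDegree := by
  classical
  unfold muTop
  exact Finset.sup_le fun β _ => rootMultiplicity_le_natDegree' _ β

/-- **the explicit threshold** `m(P) = max(3, 2μ(P)+1, e(P)+1)`. -/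
def thinThreshold (P : ℤ[X][X]) : ℕ := max 3 (max (2 * muTop P + 1) (eTop P + 1))

/-- `3 ≤ thinThreshold P`. -/
theorem three_le_thinThreshold (P : ℤ[X][X]) : 3 ≤ thinThreshold P := le_max_left _ _

/-- `thinThreshold P ≤ max 3 (max (2·deg (topX P) + 1) (deg_Y P + 1))`. -/
theorem thinThreshold_le (P : ℤ[X][X]) : thinThreshold P ≤ max 3 (max (2 * (topX P).natDegree + 1) (P.natDegree + 1)) := by
  unfold thinThreshold eTop
  have := muTop_le_natDegree P
  omega

/-- **ALL CURVES: `ThinFibreAt m₀ P` for every `P ≠ 0` and every `m₀ ≥ thinThreshold P = max(3, 2μ(P)+1, e(P)+1)`.**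
(The only Diophantine input is Ridout's theorem for rationals at the place `2`, tree `Ridout.finite_of_abs_le_one`,
entering through `ridout_window_pow`; no hypothesis binder.) -/
theorem thinFibreAt_all (P : ℤ[X][X]) (hP : P ≠ 0) {m₀ : ℕ} (hm : thinThreshold P ≤ m₀) : ThinFibreAt m₀ P := by
  have h3 : 3 ≤ m₀ := (three_le_thinThreshold P).trans hm
  have hμ : 2 * muTop P + 1 ≤ m₀ := le_trans ((le_max_left _ _).trans (le_max_right _ _)) hm
  have he : eTop P + 1 ≤ m₀ := le_trans ((le_max_right _ _).trans (le_max_right _ _)) hm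
  have hdeg : ∀ j, j < xdeg P → (xCoeff P j).natDegree ≤ (xCoeff P (xdeg P)).natDegree + eTop P := by
    intro j _
    have h1 := natDegree_xCoeff_le P j
    have h2 := natDegree_topX_le P
    show (xCoeff P j).natDegree ≤ (topX P).natDegree + (P.natDegree - (topX P).natDegree)
    omega
  have key := thinFibreAt_xPoly_mult (xdeg P) (xCoeff P) (eTop P) (max 1 (muTop P)) (topX_ne_zero hP)
    (le_max_left _ _) (fun β => (rootMultiplicity_le_muTop P β).trans (le_max_right _ _)) hdeg (by omega) he
  rwa [xPolyP_xCoeff] at key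

/-- the hypothesis-light corollary in the data `(deg c_k, deg_Y P)` only: every
`m₀ ≥ max(3, 2·deg c_k + 1, deg_Y P + 1)` … which the free regime `thinFibreAt_of_natDegree_lt` already covers —
recorded to make the point that the CONTENT of `thinFibreAt_all` is the pair `(μ, e)`, not `deg_Y`. -/
theorem thinFibreAt_all_crude (P : ℤ[X][X]) (hP : P ≠ 0) {m₀ : ℕ}
    (hm : max 3 (max (2 * (topX P).natDegree + 1) (P.natDegree + 1)) ≤ m₀) : ThinFibreAt m₀ P :=
  thinFibreAt_all P hP ((thinThreshold_le P).trans hm)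

/-- the EFFECTIVE threshold `min (deg_Y P + 1) (thinThreshold P)` (free regime ∪ this node). -/
theorem thinFibreAt_effective (P : ℤ[X][X]) (hP : P ≠ 0) {m₀ : ℕ}
    (hm : min (P.natDegree + 1) (thinThreshold P) ≤ m₀) : ThinFibreAt m₀ P := by
  rcases le_total (P.natDegree + 1) (thinThreshold P) with h | h
  · rw [min_eq_left h] at hm
    exact thinFibreAt_of_natDegree_lt (by omega)
  · rw [min_eq_right h] at hm
    exact thinFibreAt_all P hP hm

end Summit.Schanuel.Schanuel.Theorems.RootDecomp1KXAll

end
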